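import Mathlib
import HarnessLib
import Literature.Analysis.FluidPDE.LocalPressureOscillationSlab
import Literature.Analysis.FluidPDE.JiaSverak2014BoundednessNearInitialTime
import Literature.Analysis.FluidPDE.TypeIAncientMildClassical
import Literature.Analysis.FluidPDE.TaoRadialChaining
import Summits.NavierStokesRegularity.NavierStokesRegularity.Theorems.PoloidalWindowDoorPoloidalWindowRigidityPressureGradientIdentity
import Summits.NavierStokesRegularity.NavierStokesRegularity.Theorems.PoloidalWindowDoorPoloidalWindowRigidityWindow

/-!
# Route `PoloidalWindowDoor`, crux `PoloidalWindowRigidity` (K2, stmt-NavierStokesRegularity-19708) —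
# (F1) DISCHARGED: the pressure of the Type-I mild class has mean oscillation `O(C²/(−t))` on balls of radius `≥ 1`

Cell ns-regularity-ideate, seat nsreg-p7 (gen 6, third worker under the K2 lead; `--supports stmt-…-19708`).
For a profile `v` of the route's Type-I class (`‖v(t)‖ ≤ C/√(−t)`, continuous, unit-viscosity Oseen-mild between
negative times, divergence free) and ANY classical pressure `p` of `v` on a window `(t₀, 0)`
(`IsTypeIAncientMild.exists_isClassicalNSSolutionOn_Ioo` provides one):

* `sliceFunctional_eq_zero_class` — the slice pressure-gradient identities (`∇p = ∇Σℛᵢℛⱼ(vᵢvⱼ)` in the tree's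
  mollified form) hold at every `s ∈ (t₀, 0)` (`…PressureGradientIdentity` with the Type-I bound on a small time
  neighbourhood of `s`);
* `exists_integral_abs_sub_le_class` — **(F1)**: for every centre `x₀`, radius `r ≥ 1` and `s ∈ (t₀,0)` there is
  a constant `κ` with `∫_{B̄(x₀,r)} |p(s) − κ| ≤ K_osc · C²/(−s) · |B̄(x₀,r)|`, `K_osc` universal: the tree's
  Calderón–Zygmund / far-field oscillation estimate `slice_pressure_oscillation_le` (Kang–Miura–Tsai §8) fed with
  the identities, the Type-I bound, the tail `∫_{|z|≥ρ}|z|⁻⁴ = ρ⁻¹∫_{|z|≥1}|z|⁻⁴`, and Hölder `L^{3/2} → L¹` on the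
  ball.

This is exactly the hypothesis `hosc` of `…LargeScaleEnergyDecay.energy_ball_le_parabolic` (nsreg-p7 g5) and, for
radii `≥ 1`, the hypothesis `hBMO` of the K2 lead's `…LargeScaleEnergy.exists_largeScale_energy_bound`; the
UNCONDITIONAL large-scale energy decay of the class is assembled in the sibling `…LargeScaleEnergyDecayHolds`.

WHAT THIS IS NOT: not a claim about Navier–Stokes regularity and not the open residue S2⁗ — the BMO-type
pressure bound of the Type-I mild class, now a theorem (bears_on LADDER-NS N0 via crux K2 = stmt-19708).
-/

noncomputable section

-- the summit and its single sub-problem share the name (CONVENTIONS §1), as in every Theorems file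
set_option linter.dupNamespace false
-- nested operator types `ℝ³ →L[ℝ] ℝ³ →L[ℝ] ℝ³ →L[ℝ] ℝ`
set_option maxSynthPendingDepth 3

namespace Summit.NavierStokesRegularity.NavierStokesRegularity.Theorems.PoloidalWindowDoorPoloidalWindowRigidityPressureOscillation

open MeasureTheory Set Function Filter Topology Metric InnerProductSpace
open scoped RealInnerProductSpace ENNReal NNReal Laplacian ContDiff
open Literature.Analysis Literature.Analysis.FluidPDE Literature.Analysis.UnboundedOperators
open Summit.NavierStokesRegularity.NavierStokesRegularity.Theorems.PoloidalWindowDoorPoloidalWindowRigidityPressureGradientIdentity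

variable {C : ℝ} {v : ℝ → EuclideanSpace ℝ (Fin 3) → EuclideanSpace ℝ (Fin 3)}
  {p : ℝ → EuclideanSpace ℝ (Fin 3) → ℝ} {t₀ : ℝ}

/-! ## The pressure-gradient identities of the class -/

/-- **The slice pressure-gradient identities hold for the Type-I mild class**, for any classical pressure on a
window `(t₀,0)` and every `s ∈ (t₀,0)`, `δ > 0`, `c`, `e`. -/
theorem sliceFunctional_eq_zero_class (hrate : HasTypeITimeDecay C v)
    (hmild : ∀ s t : ℝ, s < t → t < 0 → ∀ x,
      v t x = heatExtension (v s) (t - s) x - oseenDuhamel 1 s v v t x)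
    (hcl : IsClassicalNSSolutionOn (Ioo t₀ 0) 1 0 v p) {s : ℝ} (hs : s ∈ Ioo t₀ 0)
    {δ : ℝ} (hδ : 0 < δ) (c e : EuclideanSpace ℝ (Fin 3)) :
    ∫ x, (p s x * fderiv ℝ (Δ (newtonReg δ)) (c - x) e +
        evalDiag (v s x) (fderiv ℝ (fderiv ℝ (fderiv ℝ (newtonReg δ))) (c - x) e)) = 0 := by
  have hC0 : 0 ≤ C := by
    have h := hrate (-1) (by norm_num) 0
    rw [neg_neg, Real.sqrt_one, div_one] at h
    exact (norm_nonneg _).trans h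
  -- a time neighbourhood of `s` inside the window
  set η : ℝ := min ((s - t₀) / 2) ((-s) / 2) with hη
  have hη0 : 0 < η := lt_min (by linarith [hs.1]) (by linarith [hs.2])
  have hη1 : η ≤ (s - t₀) / 2 := min_le_left _ _
  have hη2 : η ≤ (-s) / 2 := min_le_right _ _
  have hI : Icc (s - η) (s + η) ⊆ Ioo t₀ 0 := fun σ hσ => ⟨by linarith [hσ.1], by linarith [hσ.2]⟩
  have hsη : 0 < -(s + η) := by linarith
  -- the Type-I bound on the neighbourhood
  set M : ℝ := C / Real.sqrt (-(s + η)) with hM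
  have hM0 : 0 ≤ M := div_nonneg hC0 (Real.sqrt_nonneg _)
  have hMb : ∀ σ ∈ Icc (s - η) (s + η), ∀ y, ‖v σ y‖ ≤ M := by
    intro σ hσ y
    have hσ0 : σ < 0 := (hI hσ).2
    refine (hrate σ hσ0 y).trans ?_
    rw [hM]
    exact div_le_div_of_nonneg_left hC0 (Real.sqrt_pos.2 hsη) (Real.sqrt_le_sqrt (by linarith [hσ.2]))
  have hmild' : ∀ s' t' : ℝ, s' ∈ Icc (s - η) (s + η) → t' ∈ Icc (s - η) (s + η) → s' < t' → ∀ x,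
      v t' x = heatExtension (v s') (t' - s') x - oseenDuhamel 1 s' v v t' x :=
    fun s' t' _ ht' hlt x => hmild s' t' hlt (hI ht').2 x
  exact sliceFunctional_eq_zero_of_mild isOpen_Ioo hcl hη0 hI hM0 hMb hmild' hδ c e

/-! ## (F1): mean oscillation of the class pressure on balls of radius `≥ 1` -/

/-- **From `L^{3/2}` to `L¹` on a ball** (Hölder with the constant function):
`∫_B |f| ≤ (∫⁻_B |f|^{3/2})^{2/3}.toReal^{…}` in the convenient form
`∫⁻_B |f|^{3/2} ≤ ofReal(X³ |B|)` ⇒ `∫_B |f| ≤ X² |B|` for a continuous `f` and `X ≥ 0`. [folklore] -/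
theorem setIntegral_abs_le_of_lintegral_rpow_le {f : EuclideanSpace ℝ (Fin 3) → ℝ} (hf : Continuous f)
    (x₀ : EuclideanSpace ℝ (Fin 3)) {r X : ℝ} (hX : 0 ≤ X)
    (h : ∫⁻ c in ball x₀ r, ‖f c‖ₑ ^ (3 / 2 : ℝ) ≤
      ENNReal.ofReal (X ^ 3 * volume.real (ball x₀ r))) :
    ∫ c in ball x₀ r, |f c| ≤ X ^ 2 * volume.real (ball x₀ r) := by
  set μ : Measure (EuclideanSpace ℝ (Fin 3)) := volume.restrict (ball x₀ r) with hμ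
  haveI : IsFiniteMeasure μ := ⟨by rw [hμ, Measure.restrict_apply_univ]; exact measure_ball_lt_top⟩
  set V : ℝ := volume.real (ball x₀ r) with hV
  have hV0 : 0 ≤ V := measureReal_nonneg
  -- `|f|` is bounded on the ball, hence in every `L^p(μ)`
  obtain ⟨B, hB⟩ : ∃ B, ∀ y ∈ closedBall x₀ r, ‖f y‖ ≤ B :=
    (isCompact_closedBall x₀ r).exists_bound_of_continuousOn hf.continuousOn
  have hfm : ∀ q : ℝ≥0∞, MemLp (fun c => |f c|) q μ := fun q => by
    refine MemLp.of_bound (hf.abs.aestronglyMeasurable) (max B 0) ?_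
    rw [hμ]
    filter_upwards [ae_restrict_mem measurableSet_ball] with y hy
    rw [Real.norm_eq_abs, abs_abs]
    exact ((Real.norm_eq_abs _).symm.le.trans (hB y (ball_subset_closedBall hy))).trans (le_max_left _ _)
  have hgm : MemLp (fun _ : EuclideanSpace ℝ (Fin 3) => (1 : ℝ)) (ENNReal.ofReal 3) μ := memLp_const 1
  -- Hölder `∫ |f| · 1 ≤ (∫|f|^{3/2})^{2/3} (∫ 1)^{1/3}`
  have hpq : (3 / 2 : ℝ).HolderConjugate 3 := by
    rw [Real.holderConjugate_iff]; norm_num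
  have hH := integral_mul_le_Lp_mul_Lq_of_nonneg (μ := μ) hpq
    (Eventually.of_forall fun c => abs_nonneg (f c)) (Eventually.of_forall fun _ => zero_le_one)
    (by simpa using hfm (ENNReal.ofReal (3 / 2))) hgm
  simp only [mul_one, Real.one_rpow, integral_const, smul_eq_mul] at hH
  have hμu : μ.real univ = V := by rw [hμ, measureReal_restrict_apply_univ]
  rw [hμu] at hH
  -- the `L^{3/2}` mass as a real integral
  have hint : Integrable (fun c => |f c| ^ (3 / 2 : ℝ)) μ := by
    have h32 := (hfm (ENNReal.ofReal (3 / 2))).integrable_norm_rpow (by simp) (by simp)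
    refine h32.congr (Eventually.of_forall fun c => ?_)
    dsimp only
    rw [Real.norm_eq_abs, abs_abs, ENNReal.toReal_ofReal (by norm_num : (0 : ℝ) ≤ 3 / 2)]
  have hreal : ∫ c, |f c| ^ (3 / 2 : ℝ) ∂μ ≤ X ^ 3 * V := by
    have h1 : ENNReal.ofReal (∫ c, |f c| ^ (3 / 2 : ℝ) ∂μ) = ∫⁻ c, ‖f c‖ₑ ^ (3 / 2 : ℝ) ∂μ := by
      rw [ofReal_integral_eq_lintegral_ofReal hint (Eventually.of_forall fun c => by positivity)]
      refine lintegral_congr fun c => ?_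
      rw [← ofReal_norm, Real.norm_eq_abs, ENNReal.ofReal_rpow_of_nonneg (abs_nonneg _) (by norm_num)]
    have h2 : ENNReal.ofReal (∫ c, |f c| ^ (3 / 2 : ℝ) ∂μ) ≤ ENNReal.ofReal (X ^ 3 * V) := by rw [h1]; exact h
    exact (ENNReal.ofReal_le_ofReal_iff (by positivity)).1 h2
  -- conclude
  have hI0 : 0 ≤ ∫ c, |f c| ^ (3 / 2 : ℝ) ∂μ := integral_nonneg fun c => by positivity
  calc ∫ c, |f c| ∂μ ≤ (∫ c, |f c| ^ (3 / 2 : ℝ) ∂μ) ^ (1 / (3 / 2 : ℝ)) * V ^ (1 / (3 : ℝ)) := hH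
    _ ≤ (X ^ 3 * V) ^ (1 / (3 / 2 : ℝ)) * V ^ (1 / (3 : ℝ)) := by gcongr
    _ = X ^ 2 * V := by
        have hX3 : 0 ≤ X ^ 3 := by positivity
        rw [Real.mul_rpow hX3 hV0, show (1 / (3 / 2 : ℝ)) = 2 / 3 by norm_num,
          show X ^ 3 = X ^ (3 : ℝ) by norm_cast, ← Real.rpow_mul hX]
        norm_num
        rw [mul_assoc, ← Real.rpow_add' hV0 (by norm_num)]
        norm_num

/-- **(F1) — THE MEAN-OSCILLATION BOUND FOR THE CLASS PRESSURE.** For a profile of the route's Type-I class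
(Type-I rate `C`, Oseen-mild between negative times) and any classical pressure `p` on a window `(t₀, 0)`, there is
a universal constant `K` such that for every `s ∈ (t₀,0)`, every centre `x₀` and every radius `r ≥ 1` one finds
`κ` with `∫_{B̄(x₀,r)} |p(s,x) − κ| dx ≤ K · C²/(−s) · |B̄(x₀,r)|`. [folklore] -/
theorem exists_integral_abs_sub_le_class :
    ∃ K : ℝ, 0 ≤ K ∧ ∀ {C : ℝ} {v : ℝ → EuclideanSpace ℝ (Fin 3) → EuclideanSpace ℝ (Fin 3)}
      {p : ℝ → EuclideanSpace ℝ (Fin 3) → ℝ} {t₀ : ℝ},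
      HasTypeITimeDecay C v →
      (∀ s t : ℝ, s < t → t < 0 → ∀ x,
        v t x = heatExtension (v s) (t - s) x - oseenDuhamel 1 s v v t x) →
      t₀ < 0 → IsClassicalNSSolutionOn (Ioo t₀ 0) 1 0 v p →
      ∀ s ∈ Ioo t₀ 0, ∀ (x₀ : EuclideanSpace ℝ (Fin 3)) (r : ℝ), 1 ≤ r →
        ∃ κ : ℝ, ∫ x in closedBall x₀ r, |p s x - κ| ≤
          K * (C ^ 2 / (-s)) * volume.real (closedBall x₀ r) := by
  obtain ⟨CN, CK, hCK0, H⟩ := slice_pressure_oscillation_le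
  -- the tail mass `I₁ = ∫_{|z| ≥ 1} |z|⁻⁴`
  set I₁ : ℝ := (∫⁻ u in (ball (0 : EuclideanSpace ℝ (Fin 3)) 1)ᶜ, RieszKernel.powKer 4 u).toReal with hI₁
  have hI₁0 : 0 ≤ I₁ := ENNReal.toReal_nonneg
  -- the universal constant
  set K₁ : ℝ := (2 : ℝ) ^ (1 / 2 : ℝ) * ((CN : ℝ) ^ (3 / 2 : ℝ) * 64 + (CK * I₁ / 2) ^ (3 / 2 : ℝ)) with hK₁
  have hK₁0 : 0 ≤ K₁ := by positivity
  refine ⟨(K₁ ^ (1 / 3 : ℝ)) ^ 2, by positivity, ?_⟩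
  intro C v p t₀ hrate hmild ht₀ hcl s hs x₀ r hr
  have hr0 : 0 < r := by linarith
  have hs0 : 0 < -s := by linarith [hs.2]
  have hC0 : 0 ≤ C := by
    have h := hrate (-1) (by norm_num) 0
    rw [neg_neg, Real.sqrt_one, div_one] at h
    exact (norm_nonneg _).trans h
  -- the slice and its Type-I bound
  set M : ℝ := C / Real.sqrt (-s) with hM
  have hM0 : 0 ≤ M := div_nonneg hC0 (Real.sqrt_nonneg _)
  have hMb : ∀ y, ‖v s y‖ ≤ M := fun y => hrate s hs.2 y
  have hM2 : M ^ 2 = C ^ 2 / (-s) := by rw [hM, div_pow, Real.sq_sqrt hs0.le]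
  have hvc : Continuous (v s) := (hcl.contDiff_velocity hs).continuous
  have hpc : Continuous (p s) := (hcl.contDiff_pressure hs).continuous
  have hvm : AEStronglyMeasurable (v s) volume := hvc.aestronglyMeasurable
  set A : ℝ≥0∞ := ENNReal.ofReal (M ^ 2) * volume (ball (0 : EuclideanSpace ℝ (Fin 3)) 1) with hA
  have hAtop : A ≠ ⊤ := ENNReal.mul_ne_top ENNReal.ofReal_ne_top measure_ball_lt_top.ne
  have hAb : ∀ z : EuclideanSpace ℝ (Fin 3), ∫⁻ y in ball z 1, ‖v s y‖ₑ ^ 2 ≤ A := lintegral_ball_le_of_bound hMb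
  have hid : ∀ (n : ℕ) (c e : EuclideanSpace ℝ (Fin 3)),
      ∫ x, (p s x * fderiv ℝ (Δ (newtonReg ((n : ℝ) + 1)⁻¹)) (c - x) e +
        evalDiag (v s x) (fderiv ℝ (fderiv ℝ (fderiv ℝ (newtonReg ((n : ℝ) + 1)⁻¹))) (c - x) e)) = 0 :=
    fun n c e => sliceFunctional_eq_zero_class hrate hmild hcl hs (by positivity) c e
  obtain ⟨κ, hκ⟩ := H (v s) A (p s) hvm hAtop hAb hpc.locallyIntegrable hid x₀ r hr0
  refine ⟨κ, ?_⟩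
  -- volumes
  set V₁ : ℝ≥0∞ := volume (ball (0 : EuclideanSpace ℝ (Fin 3)) 1) with hV₁
  have hvol : ∀ (z : EuclideanSpace ℝ (Fin 3)) (ρ : ℝ), 0 < ρ →
      volume (ball z ρ) = ENNReal.ofReal (ρ ^ 3) * V₁ := by
    intro z ρ hρ
    rw [Measure.addHaar_ball volume z hρ.le, finrank_euclideanSpace_fin, hV₁]
  have hρ : 0 < 2 * (r + 1) := by positivity
  have hρ4 : 2 * (r + 1) ≤ 4 * r := by linarith
  -- the near term
  have hI3 : ∫⁻ y in ball x₀ (2 * (r + 1)), ‖v s y‖ₑ ^ (3 : ℕ) ≤ ENNReal.ofReal (M ^ 3 * (64 * r ^ 3)) * V₁ := by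
    calc ∫⁻ y in ball x₀ (2 * (r + 1)), ‖v s y‖ₑ ^ (3 : ℕ)
        ≤ ∫⁻ y in ball x₀ (2 * (r + 1)), ENNReal.ofReal (M ^ 3) := by
          refine lintegral_mono fun y => ?_
          rw [← ofReal_norm, ← ENNReal.ofReal_pow (norm_nonneg _)]
          exact ENNReal.ofReal_le_ofReal (pow_le_pow_left₀ (norm_nonneg _) (hMb y) 3)
      _ = ENNReal.ofReal (M ^ 3) * volume (ball x₀ (2 * (r + 1))) := setLIntegral_const _ _
      _ ≤ ENNReal.ofReal (M ^ 3) * volume (ball x₀ (4 * r)) := by gcongr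
      _ = ENNReal.ofReal (M ^ 3 * (64 * r ^ 3)) * V₁ := by
          rw [hvol x₀ (4 * r) (by positivity), ← mul_assoc, ← ENNReal.ofReal_mul (by positivity)]
          ring_nf
  -- the far term
  have hfar : ENNReal.ofReal (CK * (r + 1)) *
      ∫⁻ y in (ball x₀ (2 * (r + 1)))ᶜ, ‖v s y‖ₑ ^ (2 : ℕ) * RieszKernel.powKer 4 (y - x₀) ≤
        ENNReal.ofReal (CK * I₁ / 2 * M ^ 2) := by
    have h1 : ∫⁻ y in (ball x₀ (2 * (r + 1)))ᶜ, ‖v s y‖ₑ ^ (2 : ℕ) * RieszKernel.powKer 4 (y - x₀) ≤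
        ENNReal.ofReal (M ^ 2) * ∫⁻ y in (ball x₀ (2 * (r + 1)))ᶜ, RieszKernel.powKer 4 (y - x₀) := by
      rw [← lintegral_const_mul' _ _ ENNReal.ofReal_ne_top]
      refine lintegral_mono fun y => ?_
      gcongr
      rw [← ofReal_norm, ← ENNReal.ofReal_pow (norm_nonneg _)]
      exact ENNReal.ofReal_le_ofReal (pow_le_pow_left₀ (norm_nonneg _) (hMb y) 2)
    rw [JiaSverak2014.lintegral_compl_ball_powKer_four_translate x₀ hρ] at h1
    calc _ ≤ ENNReal.ofReal (CK * (r + 1)) * (ENNReal.ofReal (M ^ 2) * ENNReal.ofReal ((2 * (r + 1))⁻¹ * I₁)) := by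
          gcongr
      _ = ENNReal.ofReal (CK * I₁ / 2 * M ^ 2) := by
          rw [← ENNReal.ofReal_mul (by positivity), ← ENNReal.ofReal_mul (by positivity)]
          congr 1
          field_simp
  have hfar32 : (ENNReal.ofReal (CK * (r + 1)) *
      ∫⁻ y in (ball x₀ (2 * (r + 1)))ᶜ, ‖v s y‖ₑ ^ (2 : ℕ) * RieszKernel.powKer 4 (y - x₀)) ^ (3 / 2 : ℝ) ≤
        ENNReal.ofReal ((CK * I₁ / 2) ^ (3 / 2 : ℝ) * M ^ 3) := by
    refine (ENNReal.rpow_le_rpow hfar (by norm_num)).trans (le_of_eq ?_)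
    rw [ENNReal.ofReal_rpow_of_nonneg (by positivity) (by norm_num), Real.mul_rpow (by positivity) (by positivity)]
    congr 2
    rw [show M ^ 2 = M ^ (2 : ℝ) by norm_cast, ← Real.rpow_mul hM0]
    norm_num
  -- the oscillation bound in `L^{3/2}`
  have h32 : ∫⁻ c in ball x₀ r, ‖p s c - κ‖ₑ ^ (3 / 2 : ℝ) ≤
      ENNReal.ofReal ((K₁ ^ (1 / 3 : ℝ) * M) ^ 3 * volume.real (ball x₀ r)) := by
    refine hκ.trans ?_
    have hVr : volume (ball x₀ r) = ENNReal.ofReal (r ^ 3) * V₁ := hvol x₀ r hr0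
    have hV₁top : V₁ ≠ ⊤ := measure_ball_lt_top.ne
    have hVreal : volume.real (ball x₀ r) = r ^ 3 * V₁.toReal := by
      rw [measureReal_def, hVr, ENNReal.toReal_mul, ENNReal.toReal_ofReal (by positivity)]
    have hK13 : (K₁ ^ (1 / 3 : ℝ)) ^ 3 = K₁ := by
      rw [← Real.rpow_natCast, ← Real.rpow_mul hK₁0]; norm_num
    -- the two terms in the product-with-`V₁` form
    have e2 : (2 : ℝ≥0∞) ^ (1 / 2 : ℝ) = ENNReal.ofReal ((2 : ℝ) ^ (1 / 2 : ℝ)) := by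
      rw [show (2 : ℝ≥0∞) = ENNReal.ofReal 2 by simp, ENNReal.ofReal_rpow_of_pos (by norm_num : (0 : ℝ) < 2)]
    have eCN : (CN : ℝ≥0∞) ^ (3 / 2 : ℝ) = ENNReal.ofReal ((CN : ℝ) ^ (3 / 2 : ℝ)) := by
      rw [← ENNReal.ofReal_coe_nnreal, ENNReal.ofReal_rpow_of_nonneg (NNReal.coe_nonneg _) (by norm_num)]
    have hT1 : (CN : ℝ≥0∞) ^ (3 / 2 : ℝ) * (∫⁻ y in ball x₀ (2 * (r + 1)), ‖v s y‖ₑ ^ (3 : ℕ)) ≤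
        ENNReal.ofReal ((CN : ℝ) ^ (3 / 2 : ℝ) * (M ^ 3 * (64 * r ^ 3))) * V₁ := by
      rw [ENNReal.ofReal_mul (by positivity), ← eCN, mul_assoc]
      gcongr
    have hT2 : volume (ball x₀ r) * (ENNReal.ofReal (CK * (r + 1)) *
        ∫⁻ y in (ball x₀ (2 * (r + 1)))ᶜ, ‖v s y‖ₑ ^ (2 : ℕ) * RieszKernel.powKer 4 (y - x₀)) ^ (3 / 2 : ℝ) ≤
        ENNReal.ofReal (r ^ 3 * ((CK * I₁ / 2) ^ (3 / 2 : ℝ) * M ^ 3)) * V₁ := by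
      rw [hVr]
      calc ENNReal.ofReal (r ^ 3) * V₁ * (ENNReal.ofReal (CK * (r + 1)) *
            ∫⁻ y in (ball x₀ (2 * (r + 1)))ᶜ, ‖v s y‖ₑ ^ (2 : ℕ) * RieszKernel.powKer 4 (y - x₀)) ^ (3 / 2 : ℝ)
          ≤ ENNReal.ofReal (r ^ 3) * V₁ * ENNReal.ofReal ((CK * I₁ / 2) ^ (3 / 2 : ℝ) * M ^ 3) := by gcongr
        _ = ENNReal.ofReal (r ^ 3 * ((CK * I₁ / 2) ^ (3 / 2 : ℝ) * M ^ 3)) * V₁ := by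
            rw [ENNReal.ofReal_mul (by positivity : (0 : ℝ) ≤ r ^ 3)]; ring
    calc (2 : ℝ≥0∞) ^ (1 / 2 : ℝ) * ((CN : ℝ≥0∞) ^ (3 / 2 : ℝ) * (∫⁻ y in ball x₀ (2 * (r + 1)), ‖v s y‖ₑ ^ (3 : ℕ)) +
          volume (ball x₀ r) * (ENNReal.ofReal (CK * (r + 1)) *
            ∫⁻ y in (ball x₀ (2 * (r + 1)))ᶜ, ‖v s y‖ₑ ^ (2 : ℕ) * RieszKernel.powKer 4 (y - x₀)) ^ (3 / 2 : ℝ))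
        ≤ ENNReal.ofReal ((2 : ℝ) ^ (1 / 2 : ℝ)) *
          (ENNReal.ofReal ((CN : ℝ) ^ (3 / 2 : ℝ) * (M ^ 3 * (64 * r ^ 3))) * V₁ +
            ENNReal.ofReal (r ^ 3 * ((CK * I₁ / 2) ^ (3 / 2 : ℝ) * M ^ 3)) * V₁) := by
          rw [e2]; gcongr
      _ = ENNReal.ofReal ((K₁ ^ (1 / 3 : ℝ) * M) ^ 3 * volume.real (ball x₀ r)) := by
          have hR : ENNReal.ofReal ((K₁ ^ (1 / 3 : ℝ) * M) ^ 3 * volume.real (ball x₀ r)) =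
              ENNReal.ofReal (K₁ * M ^ 3 * r ^ 3) * V₁ := by
            rw [hVreal, mul_pow, hK13,
              show (K₁ * M ^ 3 * (r ^ 3 * V₁.toReal)) = (K₁ * M ^ 3 * r ^ 3) * V₁.toReal by ring,
              ENNReal.ofReal_mul (by positivity), ENNReal.ofReal_toReal hV₁top]
          rw [hR, ← add_mul, ← ENNReal.ofReal_add (by positivity) (by positivity), ← mul_assoc,
            ← ENNReal.ofReal_mul (by positivity)]
          congr 2
          rw [hK₁]
          ring
  -- Hölder to `L¹`, then closed ball
  have hL1 := setIntegral_abs_le_of_lintegral_rpow_le (hpc.sub continuous_const) x₀ (by positivity) h32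
  rw [setIntegral_congr_set (closedBall_ae_eq_ball_three x₀ r),
    show volume.real (closedBall x₀ r) = volume.real (ball x₀ r) by
      rw [measureReal_def, measureReal_def, Measure.addHaar_closedBall_eq_addHaar_ball]]
  refine hL1.trans (le_of_eq ?_)
  rw [mul_pow, hM2]

end Summit.NavierStokesRegularity.NavierStokesRegularity.Theorems.PoloidalWindowDoorPoloidalWindowRigidityPressureOscillation

end
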